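import Summits.CriticalPhenomena.PercolationContinuityZ3.Theses.PercMonotoneFactors
import Summits.CriticalPhenomena.PercolationContinuityZ3.Theorems.PercMonotoneFactorsClassNoJumpPlanarAnnulus
import Summits.CriticalPhenomena.PercolationContinuityZ3.Theorems.PercMonotoneFactorsClassNoJumpPlanarCriterion
import HarnessLib

/-!
# `PercMonotoneFactors.ClassNoJumpPlanar` (stmt-CriticalPhenomena-4491): no monotone finite-range
# factor of Bernoulli bond percolation on `ℤ²` jumps at its threshold

`ClassNoJumpPlanar_proof` proves the route item
`Summit.CriticalPhenomena.PercolationContinuityZ3.Theses.PercMonotoneFactors.ClassNoJumpPlanar`: for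
every admissible block rule `F` on `ℤ²` (measurable, monotone, range `R`, `Aut(ℤ²)`-equivariant,
`F ∅ = ∅`, `F E = E`, `E`-supported) and every `t ∈ [0, 1]`, if `θ_F(s) = 0` for all `s < t` then
`θ_F(t) = 0`, where `θ_F(t) = ν_t(0 ↔ ∞)`, `ν_t = P_t ∘ F⁻¹` (`blockFactorLaw 2 F t`).

Proof (Harris–Russo–Seymour–Welsh dichotomy for the dependent, positively associated, fully
symmetric planar measure `ν_t`; helper files `PercMonotoneFactorsClassNoJumpPlanar{Factor, Planar,
Annulus, Gluing, Criterion}.lean`). `t = 0`: `ν_0 = δ_∅`. `t = 1`: `ν_1 = δ_E` crosses every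
rectangle, so by continuity of local probabilities in the density and the finite-size criterion
(helper 5) `θ_F(s) > 0` for some `s < 1`, contradicting the hypothesis. `0 < t < 1`: either the
short-way dual crossings `𝓒₁(N, 8N)` of the dual measure `ν_t ∘ dualConfig⁻¹` stay `≥ ε > 0` at all
large scales — then the weak Köhler-Schindler–Tassion RSW theorem for the dual (period `1`, face
centred symmetry; all its steps are proved in the tree) and the square-annulus argument with
independence beyond range `R` give `θ_F(t) = 0` (helper 3); or they get below the universal `ε₀` of
the finite-size criterion at some scale `N ≥ R + 2` — then planar duality makes the long-way primal
crossing of `[0, 6N] × [0, 2N]` more likely than `1 - ε₀` at `t` (helper 2), hence (continuity) at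
some `s < t`, where the criterion gives `θ_F(s) > 0`: contradiction.

## References

* T. E. Harris, Proc. Cambridge Philos. Soc. 56 (1960) 13–20; B. Bollobás, O. Riordan,
  *Percolation* (2006), Ch. 3, Thm. 6 (square-annulus argument).
* L. Köhler-Schindler, V. Tassion, *Crossing probabilities for planar percolation*, Duke Math. J.
  172 (2023), Theorem 1 and Comment 1 (RSW for symmetric positively associated measures).
* G. Grimmett, *Percolation*, 2nd ed. (1999), §7.4 (static renormalisation), §11 (planar duality).
-/

noncomputable section

namespace Summit.CriticalPhenomena.PercolationContinuityZ3.Theorems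

open Literature.Probability.Percolation Literature.Probability.LatticeModels MeasureTheory Filter
open scoped Topology

namespace PercMonotoneFactorsClassNoJumpPlanar

/-- At density zero nothing percolates: `ν_0 = δ_∅` (`F ∅ = ∅`). [folklore] -/
theorem blockFactorTheta_bot {R : ℕ} {F : BondConfig (Site 2) → BondConfig (Site 2)}
    (hF : MonotoneBlockRule 2 R F) : blockFactorTheta 2 F 0 = 0 := by
  rw [blockFactorTheta, blockFactorLaw, bondPercolation, ProbabilityTheory.setBernoulli_zero,
    Measure.map_dirac' hF.measurable, hF.map_empty, ← ProbabilityTheory.setBernoulli_zero]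
  exact theta_bot (zdGraph 2) 0

/-- Elementary: a function on `[0,1]` continuous at `t > 0` exceeding `c` at `t` exceeds `c` at
some `s < t`. [folklore] -/
theorem exists_lt_of_continuousAt {g : unitInterval → ℝ} {t : unitInterval} (hg : ContinuousAt g t)
    (ht : 0 < (t : ℝ)) {c : ℝ} (hc : c < g t) : ∃ s : unitInterval, s < t ∧ c < g s := by
  have hmem : {x : unitInterval | c < g x} ∈ 𝓝 t := hg.preimage_mem_nhds (Ioi_mem_nhds hc)
  obtain ⟨δ, hδ, hball⟩ := Metric.mem_nhds_iff.1 hmem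
  set η : ℝ := min (δ / 2) ((t : ℝ) / 2) with hη
  have hη0 : 0 < η := lt_min (by linarith) (by linarith)
  have hηδ : η < δ := (min_le_left _ _).trans_lt (by linarith)
  have hηt : η ≤ (t : ℝ) / 2 := min_le_right _ _
  have hs01 : (t : ℝ) - η ∈ unitInterval := ⟨by linarith, by linarith [t.2.2]⟩
  refine ⟨⟨(t : ℝ) - η, hs01⟩, ?_, ?_⟩
  · show (t : ℝ) - η < t
    linarith
  · have : (⟨(t : ℝ) - η, hs01⟩ : unitInterval) ∈ Metric.ball t δ := by
      rw [Metric.mem_ball, Subtype.dist_eq, Real.dist_eq]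
      rw [show (t : ℝ) - η - t = -η by ring, abs_neg, abs_of_pos hη0]
      exact hηδ
    exact hball this

end PercMonotoneFactorsClassNoJumpPlanar

open PercMonotoneFactorsClassNoJumpPlanar in
/-- **The planar class theorem `ClassNoJumpPlanar`** (item stmt-CriticalPhenomena-4491 of route
`PercMonotoneFactors`): no monotone, finite-range, `Aut(ℤ²)`-equivariant factor of Bernoulli bond
percolation on `ℤ²` has a percolation probability that jumps from zero —
`(∀ s < t, θ_F(s) = 0) → θ_F(t) = 0`. [cite: KohlerSchindlerTassion2023, Theorem 1 and Comment 1] -/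
theorem ClassNoJumpPlanar_proof :
    Summit.CriticalPhenomena.PercolationContinuityZ3.Theses.PercMonotoneFactors.ClassNoJumpPlanar := by
  intro R F hmeas hmono h0 hE hsub heq hloc t ht
  have hF : MonotoneBlockRule 2 R F := ⟨hmeas, hmono, h0, hE, hsub, heq, hloc⟩
  change blockFactorTheta 2 F t = 0
  have ht' : ∀ s : unitInterval, s < t → blockFactorTheta 2 F s = 0 := ht
  obtain ⟨ε₀, hε₀, hcrit⟩ := exists_criterion
  -- KEY: a very likely long crossing at `t > 0` percolates slightly below `t`
  have key : 0 < (t : ℝ) → ∀ L : ℕ, 2 * R + 3 ≤ L →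
      1 - ε₀ < (blockFactorLaw 2 F t).real (KSTPeriodic.lrRect 0 (3 * (L : ℤ)) 0 L) → False := by
    intro ht0 L hL hbig
    obtain ⟨s, hst, hs⟩ := exists_lt_of_continuousAt
      ((continuous_real_lrRect hF 0 (3 * (L : ℤ)) 0 L).continuousAt) ht0 hbig
    exact (hcrit R F hF s L hL hs.le).ne' (ht' s hst)
  rcases eq_or_lt_of_le t.2.1 with ht0 | ht0
  · -- `t = 0`
    have : t = 0 := Subtype.ext ht0.symm
    subst this
    exact blockFactorTheta_bot hF
  rcases eq_or_lt_of_le t.2.2 with ht1 | ht1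
  · -- `t = 1`: the hypothesis fails just below `1`
    exfalso
    have : t = 1 := Subtype.ext ht1
    subst this
    refine key ht0 (2 * R + 3) le_rfl ?_
    have h1 := real_lrRect_top hF (3 * (2 * R + 3)) (2 * R + 3)
    push_cast at h1 ⊢
    rw [h1]
    linarith
  · by_cases hA : ∃ ε : ℝ, 0 < ε ∧ ∃ N₀ : ℕ, ∀ N : ℕ, N₀ ≤ N →
        ε ≤ ((blockFactorLaw 2 F t).map dualConfig).real (KSTPeriodic.crossing 1 N (8 * N))
    · obtain ⟨ε, hε, N₀, hN⟩ := hA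
      exact blockFactorTheta_eq_zero_of_dual_crossings hF ht1 hε hN
    · exfalso
      push Not at hA
      obtain ⟨N, hN, hlt⟩ := hA ε₀ hε₀ (R + 2)
      refine key ht0 (2 * N) (by omega) ?_
      haveI := isProbabilityMeasure_blockFactorLaw hF t
      have hD := one_sub_dual_crossing_le_real_lrRect (admissible_blockFactorLaw hF t)
        (latticeCarried_blockFactorLaw hF t) (N := N) (by omega)
      have hcast : (3 * ((2 * N : ℕ) : ℤ)) = 6 * (N : ℤ) := by push_cast; ring
      rw [hcast]
      push_cast
      linarith
end Summit.CriticalPhenomena.PercolationContinuityZ3.Theorems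

end
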